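/-
Copyright (c) 2026. All rights reserved.
Released under Apache 2.0 license as described in the file LICENSE.
Authors: abc-iut cell, prover seat abc-iut-f-101 (F fact-proving wave), over the statements of abc-iut-L4-t3.
-/
import Literature.AnabelianGeometry.AbsoluteAnabelian.LogFrobeniusMonoAnalyticization
import Literature.AnabelianGeometry.AbsoluteAnabelian.LogFrobeniusMonoBaseFacts
import HarnessLib

/-!
# [AbsTopIII] Corollary 5.10 (iv)(a)/(b): the mono-analyticization homotopies are NECESSARY for the mono-analytic cores — `Cor510MonoCores` (FACT-LIST F-0138) located EXACTLY; a necessary condition for `Cor510MonoTelecore` (F-0139)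

S. Mochizuki, *Topics in absolute anabelian geometry III: global reconstruction algorithms*,
J. Math. Sci. Univ. Tokyo 22 (2015) 939–1156 [MochizukiAbsTopIII2015]; locators `p.N` = pages of the author's
manuscript (`paper:url-5493eb38cbb7`): Def 3.5 (iii) pp. 75–76 (cores: the boundary set contains ALL co-verticial pairs
into the core vertex; a core is symmetric, its homotopies are isomorphisms), Def 5.6 (iii)–(iv) pp. 135–136 (the
1-commutative mono-analyticization diagrams), Cor 5.10 preamble p. 146 ("mono-analyticization homotopies"), (iv)(a)/(b)
p. 147.

PROOF-ONLY companion of abc-iut-L4-t3's `LogFrobeniusCorollaries.lean` (`Cor510MonoCores` = F-0138, `Cor510MonoTelecore`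
= F-0139) and of the add-on interface `LogFrobeniusMonoAnalyticization.lean` (`MonoAnalyticizationHomotopies`: the rows
4 → 5 and 6 → 7 homotopies the frozen `LogFrobeniusSetting` omits; SUFFICIENCY `cor510MonoCores_holds`, equivalently
abc-iut-L4-t15's `cor510MonoCores_of` from `hN`, `hκ`).  This file proves the CONVERSE:

* `iso_of_isCoreOn` — a core structure of `D_{≤P} ∪ {x}` on `D_{≤P}` (t3's `IsCoreOn`) yields an ISOMORPHISM between the
  functors of any two co-verticial paths into `x` (Def 3.5 (iii): all such pairs are boundary pairs of a symmetric family);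
* `toE_iso_of_isCoreOn_emono5` — from the core `ℰ⊢` of `D•⊢_{≤4} ∪ D•_{≤5}` (the `n = 5` clause of Cor 5.10 (iv)(a)):
  the rows 4 → 5 homotopy `𝒩_v → 𝒩⊢_v → ℰ⊢ ≅ 𝒩_v → ℰ• → ℰ⊢` (`hN`) at every `v`, from the two length-2 paths `𝒩_v ⇉ ℰ⊢`;
* `anToE_iso_of_isCoreOn_emono7` — from the core `ℰ⊢` of `D•⊢_{≤6} ∪ D•_{≤7}` (`n = 7`): the rows 6 → 7 homotopy
  `An•[𝒳] → An⊢[𝒩⊢⊞] → ℰ⊢ ≅ An•[𝒳] → ℰ• → ℰ⊢` (the add-on's `anToE`), from the two length-2 paths `An•[𝒳] ⇉ ℰ⊢`;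
* `toE_iso_of_isCoreOn_anMono` — from the core `An⊢[𝒩⊢⊞]` of `D•⊢_{≤5} ∪ D•_{≤6}` (`n = 6`, the core clause of
  Cor 5.10 (iv)(b), F-0139): again `hN`, by cancelling the Prop 5.8 (vii) equivalence `ℰ⊢ ⥲ An⊢[𝒩⊢⊞]` from the two
  length-3 paths `𝒩_v ⇉ An⊢`;
* `nonempty_monoAnalyticizationHomotopies_of_cor510MonoCores` and the EXACT location of F-0138:
  `cor510MonoCores_iff : L.Cor510MonoCores ↔ Nonempty Vmod ∧ Nonempty L.MonoAnalyticizationHomotopies`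
  (⇐: `cor510MonoCores_holds`; `V(F_mod) ≠ ∅` by t15's `not_cor510MonoCores_of_isEmpty`);
* `toE_iso_of_cor510MonoTelecore` — the rows 4 → 5 homotopy is NECESSARY for F-0139 as typed (its failing witness in
  `LogFrobeniusMonoTelecoreCalibration.lean` violated exactly this); `etaMono_iso_of_cor510MonoTelecore` — so are the
  printed ISOMORPHISMS `η⊢_{v,ν}` of Cor 5.10 (iv)(c) between the functors of `□ → 𝒩⊞_v → 𝒩_v → ℰ• → ℰ⊢ → An⊢ → 𝒩⊢⊞_v` and
  `□ → 𝒩⊞_v → 𝒩⊢⊞_v` (the contact structure contains the pair in both orders; such a pair carries an isomorphism,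
  `HomotopyFamily.isIso_of_mem_mem`).

So the typed Cor 5.10 (iv)(a) is EQUIVALENT, over the interface, to (nonempty index set +) the two printed
mono-analyticization homotopies — interface omissions named by the add-on, not new facts.  Refereed pre-IUT material;
nothing here bears on [IUTchIII] Cor. 3.12; OUR kernel check, no side taken.
-/

set_option autoImplicit false

universe u v' u' w'

open CategoryTheory Quiver

namespace Literature.AnabelianGeometry.AbsoluteAnabelian

namespace LogFrobeniusSetting

variable {Vmod : Type u} {isArc : Vmod → Bool} (L : LogFrobeniusSetting Vmod isArc)

/-! ## A core structure identifies the functors of co-verticial paths into the core vertex -/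

/-- **Def 3.5 (iii) unwound**: a core structure of `D_{≤P} ∪ {x}` on `D_{≤P}` gives, for any two co-verticial paths into
the core vertex, an ISOMORPHISM between their functors (every such pair is a boundary pair, and a core is symmetric, so
its homotopies are invertible). [cite: MochizukiAbsTopIII2015, Definition 3.5 (iii) pp.75–76] -/
theorem iso_of_isCoreOn {P : DVertex Vmod isArc → Prop} {x : DVertex Vmod isArc} (h : L.IsCoreOn P x)
    {a : (obsShape P x).Vertex} (p q : Path a (obsShape P x).obs) :
    Nonempty (((L.subdiagram P).extend (L.obsExt P x)).pathFunctor p ≅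
      ((L.subdiagram P).extend (L.obsExt P x)).pathFunctor q) := by
  obtain ⟨H, hH, hc⟩ := h
  have hE : H.E p q := hc.boundary_all p q
  haveI : IsIso (H.η hE) := DiagramOfCategories.HomotopyFamily.isIso_of_isSymmetric _ H hc.isSymmetric hE
  exact ⟨asIso (H.η hE)⟩

/-! ## `n = 5`: the core `ℰ⊢` forces the rows 4 → 5 homotopy -/

/-- **The rows 4 → 5 mono-analyticization homotopy is necessary for the `n = 5` mono-analytic core**: a core structure of
`D•⊢_{≤5}` on `D•⊢_{≤4} ∪ D•_{≤5}` identifies the functors of the two length-2 paths `𝒩_v → ℰ• → ℰ⊢` and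
`𝒩_v → 𝒩⊢_v → ℰ⊢`, i.e. yields `𝒩_v → 𝒩⊢_v → ℰ⊢ ≅ 𝒩_v → ℰ• → ℰ⊢` (Def 5.6 (iv), the hypothesis `hN` of
`cor510MonoCores_of`). [cite: MochizukiAbsTopIII2015, Cor 5.10 (iv)(a) p.147] -/
theorem toE_iso_of_isCoreOn_emono5 (h : L.IsCoreOn (monoBase 5) .emono5) (v : Vmod) :
    Nonempty (L.monoN v ⋙ L.toEmono v ≅ L.toE v ⋙ L.monoAn) := by
  let X : ExtShape.{u} (DSub (monoBase (Vmod := Vmod) (isArc := isArc) 5)) := obsShape (monoBase 5) DVertex.emono5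
  have hnv : monoBase (isArc := isArc) 5 (.nv v) := Or.inl ⟨trivial, by simp [DVertex.row]⟩
  have he5 : monoBase (Vmod := Vmod) (isArc := isArc) 5 .e5 := Or.inl ⟨trivial, by simp [DVertex.row]⟩
  have hnm : monoBase (isArc := isArc) 5 (.nmono v) := Or.inr ⟨not_false, by simp [DVertex.row]⟩
  let a : X.Vertex := X.base ⟨.nv v, hnv⟩
  let p : Path a X.obs :=
    (Path.nil.cons (show a ⟶ X.base ⟨.e5, he5⟩ from DEdge.toE v)).cons (show X.base ⟨.e5, he5⟩ ⟶ X.obs from DEdge.monoE5)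
  let q : Path a X.obs :=
    (Path.nil.cons (show a ⟶ X.base ⟨.nmono v, hnm⟩ from DEdge.monoN v)).cons
      (show X.base ⟨.nmono v, hnm⟩ ⟶ X.obs from DEdge.toEmono v)
  obtain ⟨φ⟩ := L.iso_of_isCoreOn h p q
  have hp : ((L.subdiagram (monoBase 5)).extend (L.obsExt (monoBase 5) .emono5)).pathFunctor p = L.toE v ⋙ L.monoAn := by
    rw [DiagramOfCategories.pathFunctor_cons, DiagramOfCategories.pathFunctor_cons, DiagramOfCategories.pathFunctor_nil]
    rfl
  have hq : ((L.subdiagram (monoBase 5)).extend (L.obsExt (monoBase 5) .emono5)).pathFunctor q =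
      L.monoN v ⋙ L.toEmono v := by
    rw [DiagramOfCategories.pathFunctor_cons, DiagramOfCategories.pathFunctor_cons, DiagramOfCategories.pathFunctor_nil]
    rfl
  exact ⟨eqToIso hq.symm ≪≫ φ.symm ≪≫ eqToIso hp⟩

/-! ## `n = 7`: the core `ℰ⊢` of row 7 forces the rows 6 → 7 homotopy -/

/-- **The rows 6 → 7 mono-analyticization homotopy is necessary for the `n = 7` mono-analytic core**: a core structure of
`D•⊢_{≤7}` on `D•⊢_{≤6} ∪ D•_{≤7}` identifies the functors of `An•[𝒳] → An⊢[𝒩⊢⊞] → ℰ⊢` and `An•[𝒳] → ℰ• → ℰ⊢` — the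
add-on's `anToE`. [cite: MochizukiAbsTopIII2015, Cor 5.10 (iv)(a) p.147] -/
theorem anToE_iso_of_isCoreOn_emono7 (h : L.IsCoreOn (monoBase 7) .emono7) :
    Nonempty ((L.κAn.inverse ⋙ L.monoAn ⋙ L.κAnMono.functor) ⋙ L.κAnMono.inverse ≅ L.κAn₂.functor ⋙ L.monoAn) := by
  let X : ExtShape.{u} (DSub (monoBase (Vmod := Vmod) (isArc := isArc) 7)) := obsShape (monoBase 7) DVertex.emono7
  have han : monoBase (Vmod := Vmod) (isArc := isArc) 7 .an := Or.inl ⟨trivial, by simp [DVertex.row]⟩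
  have he7 : monoBase (Vmod := Vmod) (isArc := isArc) 7 .e7 := Or.inl ⟨trivial, by simp [DVertex.row]⟩
  have ham : monoBase (Vmod := Vmod) (isArc := isArc) 7 .anMono := Or.inr ⟨not_false, by simp [DVertex.row]⟩
  let a : X.Vertex := X.base ⟨.an, han⟩
  let p : Path a X.obs :=
    (Path.nil.cons (show a ⟶ X.base ⟨.anMono, ham⟩ from DEdge.monoAn)).cons
      (show X.base ⟨.anMono, ham⟩ ⟶ X.obs from DEdge.anMonoToE)
  let q : Path a X.obs :=
    (Path.nil.cons (show a ⟶ X.base ⟨.e7, he7⟩ from DEdge.anToE)).cons (show X.base ⟨.e7, he7⟩ ⟶ X.obs from DEdge.monoE7)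
  obtain ⟨φ⟩ := L.iso_of_isCoreOn h p q
  have hp : ((L.subdiagram (monoBase 7)).extend (L.obsExt (monoBase 7) .emono7)).pathFunctor p =
      (L.κAn.inverse ⋙ L.monoAn ⋙ L.κAnMono.functor) ⋙ L.κAnMono.inverse := by
    rw [DiagramOfCategories.pathFunctor_cons, DiagramOfCategories.pathFunctor_cons, DiagramOfCategories.pathFunctor_nil]
    rfl
  have hq : ((L.subdiagram (monoBase 7)).extend (L.obsExt (monoBase 7) .emono7)).pathFunctor q =
      L.κAn₂.functor ⋙ L.monoAn := by
    rw [DiagramOfCategories.pathFunctor_cons, DiagramOfCategories.pathFunctor_cons, DiagramOfCategories.pathFunctor_nil]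
    rfl
  exact ⟨eqToIso hp.symm ≪≫ φ ≪≫ eqToIso hq⟩

/-! ## `n = 6`: the core `An⊢[𝒩⊢⊞]` (Cor 5.10 (iv)(b)) forces the rows 4 → 5 homotopy -/

/-- Cancelling an equivalence on the right of an isomorphism of composite functors. [folklore] -/
private theorem nonempty_iso_of_iso_comp_equivalence {A B C' : Type (u + 1)} [Category.{u} A] [Category.{u} B]
    [Category.{u} C'] {F G : A ⥤ B} (e : B ≌ C') (φ : F ⋙ e.functor ≅ G ⋙ e.functor) : Nonempty (F ≅ G) :=
  ⟨F.rightUnitor.symm ≪≫ Functor.isoWhiskerLeft F e.unitIso ≪≫ (Functor.associator _ _ _).symm ≪≫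
      Functor.isoWhiskerRight φ e.inverse ≪≫ Functor.associator _ _ _ ≪≫ Functor.isoWhiskerLeft G e.unitIso.symm ≪≫
      G.rightUnitor⟩

/-- **The rows 4 → 5 homotopy is necessary for the `n = 6` mono-analytic core** (the core clause of Cor 5.10 (iv)(b)): a
core structure of `D•⊢_{≤6}` on `D•⊢_{≤5} ∪ D•_{≤6}` identifies the functors of the two length-3 paths
`𝒩_v → ℰ• → ℰ⊢ → An⊢` and `𝒩_v → 𝒩⊢_v → ℰ⊢ → An⊢`; cancelling the Prop 5.8 (vii) equivalence `ℰ⊢ ⥲ An⊢[𝒩⊢⊞]` gives `hN`.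
[cite: MochizukiAbsTopIII2015, Cor 5.10 (iv)(b) p.147] -/
theorem toE_iso_of_isCoreOn_anMono (h : L.IsCoreOn (monoBase 6) .anMono) (v : Vmod) :
    Nonempty (L.monoN v ⋙ L.toEmono v ≅ L.toE v ⋙ L.monoAn) := by
  let X : ExtShape.{u} (DSub (monoBase (Vmod := Vmod) (isArc := isArc) 6)) := obsShape (monoBase 6) DVertex.anMono
  let a : X.Vertex := X.base ⟨.nv v, monoBase_six_nv v⟩
  let p : Path a X.obs :=
    ((Path.nil.cons (show a ⟶ X.base ⟨.e5, monoBase_six_e5⟩ from DEdge.toE v)).cons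
      (show X.base ⟨.e5, monoBase_six_e5⟩ ⟶ X.base ⟨.emono5, monoBase_six_emono5⟩ from DEdge.monoE5)).cons
      (show X.base ⟨.emono5, monoBase_six_emono5⟩ ⟶ X.obs from DEdge.κAnMono)
  let q : Path a X.obs :=
    ((Path.nil.cons (show a ⟶ X.base ⟨.nmono v, monoBase_six_nmono v⟩ from DEdge.monoN v)).cons
      (show X.base ⟨.nmono v, monoBase_six_nmono v⟩ ⟶ X.base ⟨.emono5, monoBase_six_emono5⟩ from
        DEdge.toEmono v)).cons
      (show X.base ⟨.emono5, monoBase_six_emono5⟩ ⟶ X.obs from DEdge.κAnMono)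
  obtain ⟨φ⟩ := L.iso_of_isCoreOn h p q
  have hp : ((L.subdiagram (monoBase 6)).extend (L.obsExt (monoBase 6) .anMono)).pathFunctor p =
      (L.toE v ⋙ L.monoAn) ⋙ L.κAnMono.functor := by
    rw [DiagramOfCategories.pathFunctor_cons, DiagramOfCategories.pathFunctor_cons,
      DiagramOfCategories.pathFunctor_cons, DiagramOfCategories.pathFunctor_nil]
    rfl
  have hq : ((L.subdiagram (monoBase 6)).extend (L.obsExt (monoBase 6) .anMono)).pathFunctor q =
      (L.monoN v ⋙ L.toEmono v) ⋙ L.κAnMono.functor := by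
    rw [DiagramOfCategories.pathFunctor_cons, DiagramOfCategories.pathFunctor_cons,
      DiagramOfCategories.pathFunctor_cons, DiagramOfCategories.pathFunctor_nil]
    rfl
  exact nonempty_iso_of_iso_comp_equivalence L.κAnMono (eqToIso hq.symm ≪≫ φ.symm ≪≫ eqToIso hp)

/-! ## F-0138 located exactly; a necessary condition for F-0139 -/

/-- **The mono-analyticization homotopies are necessary for Cor 5.10 (iv)(a) as typed**: `Cor510MonoCores L` yields the
add-on `MonoAnalyticizationHomotopies L` (rows 4 → 5 from the `n = 5` core, rows 6 → 7 from the `n = 7` core).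
[cite: MochizukiAbsTopIII2015, Cor 5.10 (iv)(a) p.147] -/
theorem nonempty_monoAnalyticizationHomotopies_of_cor510MonoCores (h : L.Cor510MonoCores) :
    Nonempty L.MonoAnalyticizationHomotopies :=
  ⟨{ toE := fun v => (L.toE_iso_of_isCoreOn_emono5 h.1 v).some
     anToE := (L.anToE_iso_of_isCoreOn_emono7 h.2.2).some }⟩

/-- **F-0138 (`Cor510MonoCores`) LOCATED EXACTLY over the interface**: the typed Cor 5.10 (iv)(a) holds iff the index set
is nonempty and the setting carries the two printed mono-analyticization homotopies (the add-on
`MonoAnalyticizationHomotopies`; ⇐ is abc-iut-L4-t3's `cor510MonoCores_holds` = abc-iut-L4-t15's `cor510MonoCores_of`,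
`V(F_mod) ≠ ∅` is t15's `not_cor510MonoCores_of_isEmpty`). [cite: MochizukiAbsTopIII2015, Cor 5.10 (iv)(a) p.147] -/
theorem cor510MonoCores_iff :
    L.Cor510MonoCores ↔ Nonempty Vmod ∧ Nonempty L.MonoAnalyticizationHomotopies := by
  refine ⟨fun h => ⟨?_, L.nonempty_monoAnalyticizationHomotopies_of_cor510MonoCores h⟩, fun ⟨⟨v⟩, ⟨M⟩⟩ => ?_⟩
  · by_contra hV
    rw [not_nonempty_iff] at hV
    exact L.not_cor510MonoCores_of_isEmpty h
  · haveI : Nonempty Vmod := ⟨v⟩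
    exact L.cor510MonoCores_holds M

/-- The same in abc-iut-L4-t15's terms: `Cor510MonoCores L` iff `V(F_mod) ≠ ∅` and the hypotheses `hN`, `hκ` of
`cor510MonoCores_of` hold. [cite: MochizukiAbsTopIII2015, Cor 5.10 (iv)(a) p.147] -/
theorem cor510MonoCores_iff_inputs :
    L.Cor510MonoCores ↔ Nonempty Vmod ∧ (∀ v : Vmod, Nonempty (L.monoN v ⋙ L.toEmono v ≅ L.toE v ⋙ L.monoAn)) ∧
      Nonempty (L.κAn₂.functor ⋙ L.monoAn ≅ L.κAn.inverse ⋙ L.monoAn) := by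
  refine ⟨fun h => ⟨(L.cor510MonoCores_iff.mp h).1, fun v => L.toE_iso_of_isCoreOn_emono5 h.1 v, ?_⟩,
    fun ⟨⟨v⟩, hN, hκ⟩ => ?_⟩
  · obtain ⟨M⟩ := L.nonempty_monoAnalyticizationHomotopies_of_cor510MonoCores h
    exact ⟨M.anToE'⟩
  · haveI : Nonempty Vmod := ⟨v⟩
    exact L.cor510MonoCores_of hN hκ

/-- **The rows 4 → 5 homotopy is necessary for Cor 5.10 (iv)(b)(c) as typed** (`Cor510MonoTelecore`, F-0139): its core
clause is the `n = 6` mono-analytic core. [cite: MochizukiAbsTopIII2015, Cor 5.10 (iv)(b) p.147] -/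
theorem toE_iso_of_cor510MonoTelecore (h : L.Cor510MonoTelecore) (v : Vmod) :
    Nonempty (L.monoN v ⋙ L.toEmono v ≅ L.toE v ⋙ L.monoAn) := by
  obtain ⟨H, hH, hc, -⟩ := h
  exact L.toE_iso_of_isCoreOn_anMono ⟨H, hH, hc⟩ v

/-- In a family of homotopies a pair of paths that is a boundary pair IN BOTH ORDERS carries an isomorphism
(Def 3.5 (ii): `ζ_{(γ,γ)} = id`, `ζ` multiplicative). [cite: MochizukiAbsTopIII2015, Definition 3.5 (ii) p.75] -/
theorem _root_.Literature.AnabelianGeometry.AbsoluteAnabelian.DiagramOfCategories.HomotopyFamily.isIso_of_mem_mem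
    {V : Type w'} [Quiver.{v'} V] {D : DiagramOfCategories.{v', u', w'} V} (H : D.HomotopyFamily)
    {a b : V} {p q : Path a b} (h : H.E p q) (h' : H.E q p) : IsIso (H.η h) := by
  refine ⟨H.η h', ?_, ?_⟩
  · rw [← H.η_trans h h', H.η_refl]
  · rw [← H.η_trans h' h, H.η_refl]

/-- **The printed isomorphisms `η⊢_{v,ν}` are necessary for Cor 5.10 (iv)(c) as typed**: `Cor510MonoTelecore L` yields,
for every `v` and every vertex `ν` of `Γ⃗^×_v`, an isomorphism between the functors of the length-6 path
`□ → 𝒩⊞_v → 𝒩_v → ℰ• → ℰ⊢ → An⊢[𝒩⊢⊞] →(φ^{An⊢⊞}_{v,ν}) 𝒩⊢⊞_v` and of the length-2 path `□ → 𝒩⊞_v → 𝒩⊢⊞_v` — the contact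
structure `ℋ_{An⊢}` contains the pair in both orders, and a pair that is a boundary pair in both orders carries an
isomorphism. [cite: MochizukiAbsTopIII2015, Cor 5.10 (iv)(c) p.148] -/
theorem etaMono_iso_of_cor510MonoTelecore (h : L.Cor510MonoTelecore) (v : Vmod) (ν : LogVertex (isArc v))
    (hν : ν.IsCross) :
    Nonempty (L.lam v ν ⋙ L.forget v ⋙ L.toE v ⋙ L.monoAn ⋙ L.κAnMono.functor ⋙ L.ψAnMono v ⟨ν, hν⟩ ≅
      L.lam v ν ⋙ L.monoNplus v) := by
  obtain ⟨H, hH, hc, T, hJ, hT, Hc, -, hpairs⟩ := h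
  obtain ⟨J, telMap, Jfam, hb, hpi, hrE, hrη⟩ := T
  change J = fun a => MonoTelecoreIdx a.1 at hJ
  subst hJ
  change HEq (fun (a : DSub (monoBase (isArc := isArc) 6)) (j : MonoTelecoreIdx a.1) => telMap j)
    (fun (a : DSub (monoBase (isArc := isArc) 6)) (j : MonoTelecoreIdx a.1) => L.monoTelecoreFun a.1 j) at hT
  have hT' : ∀ (a : DSub (monoBase (isArc := isArc) 6)) (j : MonoTelecoreIdx a.1), telMap j = L.monoTelecoreFun a.1 j :=
    fun a j => congrFun (congrFun (eq_of_heq hT) a) j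
  obtain ⟨h₁₀, h₀₁⟩ := hpairs v ν hν monoBase_six_core (monoBase_six_nplus v) (monoBase_six_nv v) monoBase_six_e5
    monoBase_six_emono5 (monoBase_six_nmonoPlus v) (ULift.up ⟨ν, hν⟩)
  have hi : IsIso (Hc.η h₁₀) := Hc.isIso_of_mem_mem h₁₀ h₀₁
  refine ⟨eqToIso ?_ ≪≫ @asIso _ _ _ _ (Hc.η h₁₀) hi ≪≫ eqToIso ?_⟩
  · rw [DiagramOfCategories.pathFunctor_cons, DiagramOfCategories.pathFunctor_cons,
      DiagramOfCategories.pathFunctor_cons, DiagramOfCategories.pathFunctor_cons,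
      DiagramOfCategories.pathFunctor_cons, DiagramOfCategories.pathFunctor_cons, DiagramOfCategories.pathFunctor_nil]
    change _ = (((((𝟭 _ ⋙ L.lam v ν) ⋙ L.forget v) ⋙ L.toE v) ⋙ L.monoAn) ⋙ L.κAnMono.functor) ⋙
      telMap (a := ⟨.nmonoPlus v, monoBase_six_nmonoPlus v⟩)
        (show MonoTelecoreIdx (DVertex.nmonoPlus (isArc := isArc) v) from ULift.up ⟨ν, hν⟩)
    rw [hT' ⟨.nmonoPlus v, monoBase_six_nmonoPlus v⟩
      (show MonoTelecoreIdx (DVertex.nmonoPlus (isArc := isArc) v) from ULift.up ⟨ν, hν⟩)]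
    rfl
  · rw [DiagramOfCategories.pathFunctor_cons, DiagramOfCategories.pathFunctor_cons, DiagramOfCategories.pathFunctor_nil]
    rfl

end LogFrobeniusSetting

end Literature.AnabelianGeometry.AbsoluteAnabelian
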